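import Summits.Ventures.PercRepro.SevenThreeStarTable

/-!
# PercRepro — the `(7,3)` cell: the cyclic count of the star table as a subset count (p3, gen 16)

The star table (`SevenThreeStarTable.lean`) computes `cyc cs j`, the number of `j`-subsets of a union of classes of
sizes `cs` meeting at least three classes or exactly two classes with at least two points in each, by the structural
recursion `cycRec`. This file identifies the recursion with the subset count: for a list `L` of pairwise disjoint
finsets, `cycRec (L.map card) rem hits min2 mult = mult · #{C ⊆ ⋃L : |C| = rem, cycCond (hits + hitsL L C) (min2 && min2L L C)}`
(`cycRec_eq_card`), where `hitsL L C` is the number of members of `L` met by `C` and `min2L L C` says that every member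
met is met in at least two points. The tool is the split of the subsets of a disjoint union `N ∪ U` into pairs
`(A ⊆ N, B ⊆ U)` (`card_filter_powerset_union`) and `Finset.sum_powerset_apply_card`.
(`P3-C025-seven-three-plan.md` §9 (R2): the transfer of Lemma 27.2 to the kernel table.)
-/

namespace PercRepro

namespace SevenThree

namespace CycCount

open Finset

variable {α : Type*} [DecidableEq α]

/-- The number of members of `L` met by `C`. -/
def hitsL (L : List (Finset α)) (C : Finset α) : ℕ := (L.filter (fun N => (C ∩ N).Nonempty)).length

/-- Every member of `L` met by `C` is met in at least two points. -/
def min2L (L : List (Finset α)) (C : Finset α) : Bool := L.all (fun N => decide (C ∩ N = ∅ ∨ 2 ≤ (C ∩ N).card))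

/-- The cyclic condition of the table: at least three classes met, or exactly two with `min2`. -/
def cycCond (h : ℕ) (m : Bool) : Prop := 3 ≤ h ∨ (h = 2 ∧ m = true)

/-- `cycCond` is decidable (it is a Boolean combination of decidable atoms). -/
instance (h : ℕ) (m : Bool) : Decidable (cycCond h m) := by unfold cycCond; infer_instance

/-- The union of a list of finsets. -/
def unionL (L : List (Finset α)) : Finset α := L.foldr (· ∪ ·) ∅

/-- `unionL [] = ∅`. -/
theorem unionL_nil : unionL ([] : List (Finset α)) = ∅ := rfl

/-- `unionL (N :: L) = N ∪ unionL L`. -/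
theorem unionL_cons (N : Finset α) (L : List (Finset α)) : unionL (N :: L) = N ∪ unionL L := rfl

/-- `hitsL [] C = 0`. -/
theorem hitsL_nil (C : Finset α) : hitsL ([] : List (Finset α)) C = 0 := rfl

/-- `min2L [] C = true`. -/
theorem min2L_nil (C : Finset α) : min2L ([] : List (Finset α)) C = true := rfl

/-- `hitsL (N :: L) C = [C ∩ N ≠ ∅] + hitsL L C`. -/
theorem hitsL_cons (N : Finset α) (L : List (Finset α)) (C : Finset α) :
    hitsL (N :: L) C = (if (C ∩ N).Nonempty then 1 else 0) + hitsL L C := by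
  unfold hitsL
  rw [List.filter_cons]
  by_cases h : (C ∩ N).Nonempty
  · simp [h, Nat.add_comm]
  · simp [h]

/-- `min2L (N :: L) C = (C ∩ N = ∅ ∨ 2 ≤ |C ∩ N|) && min2L L C`. -/
theorem min2L_cons (N : Finset α) (L : List (Finset α)) (C : Finset α) :
    min2L (N :: L) C = (decide (C ∩ N = ∅ ∨ 2 ≤ (C ∩ N).card) && min2L L C) := by
  unfold min2L
  rw [List.all_cons]

omit [DecidableEq α] in
/-- A member of `L` is disjoint from `N` when `N :: L` is pairwise disjoint. -/
theorem disjoint_of_pairwise_cons {N : Finset α} {L : List (Finset α)} (h : (N :: L).Pairwise Disjoint) :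
    ∀ N' ∈ L, Disjoint N N' := by
  rw [List.pairwise_cons] at h
  exact h.1

/-- `N` is disjoint from `unionL L` when `N :: L` is pairwise disjoint. -/
theorem disjoint_unionL_of_pairwise_cons {N : Finset α} {L : List (Finset α)} (h : (N :: L).Pairwise Disjoint) :
    Disjoint N (unionL L) := by
  have hd := disjoint_of_pairwise_cons h
  clear h
  induction L with
  | nil => simp [unionL_nil]
  | cons N' L ih =>
    rw [unionL_cons, Finset.disjoint_union_right]
    exact ⟨hd N' (List.mem_cons_self ..), ih (fun N'' hN'' => hd N'' (List.mem_cons_of_mem N' hN''))⟩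

/-- `hitsL` and `min2L` of `A ∪ B` over `L` for `A ⊆ N`, `N` disjoint from the members of `L`: only `B` counts. -/
theorem hitsL_union_of_subset {N A B : Finset α} {L : List (Finset α)} (hd : ∀ N' ∈ L, Disjoint N N') (hA : A ⊆ N) :
    hitsL L (A ∪ B) = hitsL L B := by
  unfold hitsL
  congr 1
  refine List.filter_congr (fun N' hN' => ?_)
  have hAN' : A ∩ N' = ∅ := Finset.disjoint_iff_inter_eq_empty.1 ((hd N' hN').mono_left hA)
  rw [Finset.union_inter_distrib_right, hAN', Finset.empty_union]

/-- `min2L L (A ∪ B) = min2L L B` in the same situation. -/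
theorem min2L_union_of_subset {N A B : Finset α} {L : List (Finset α)} (hd : ∀ N' ∈ L, Disjoint N N') (hA : A ⊆ N) :
    min2L L (A ∪ B) = min2L L B := by
  induction L with
  | nil => rfl
  | cons N' L ih =>
    rw [min2L_cons, min2L_cons, ih (fun N'' hN'' => hd N'' (List.mem_cons_of_mem N' hN''))]
    have hAN' : A ∩ N' = ∅ :=
      Finset.disjoint_iff_inter_eq_empty.1 ((hd N' (List.mem_cons_self ..)).mono_left hA)
    rw [Finset.union_inter_distrib_right, hAN', Finset.empty_union]

/-- `(A ∪ B) ∩ N = A` for `A ⊆ N` and `B` disjoint from `N`. -/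
theorem union_inter_eq_left {N A B : Finset α} (hA : A ⊆ N) (hB : Disjoint B N) : (A ∪ B) ∩ N = A := by
  rw [Finset.union_inter_distrib_right, Finset.disjoint_iff_inter_eq_empty.1 hB, Finset.union_empty]
  exact Finset.inter_eq_left.2 hA

/-- **The split of the subsets of a disjoint union**: for `Disjoint N U`,
`#{C ⊆ N ∪ U : P C} = Σ_{A ⊆ N} #{B ⊆ U : P (A ∪ B)}`. -/
theorem card_filter_powerset_union {N U : Finset α} (hNU : Disjoint N U) (P : Finset α → Prop) [DecidablePred P] :
    ((N ∪ U).powerset.filter P).card = ∑ A ∈ N.powerset, (U.powerset.filter (fun B => P (A ∪ B))).card := by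
  rw [Finset.card_eq_sum_card_fiberwise (f := fun C => C ∩ N) (t := N.powerset)]
  · apply Finset.sum_congr rfl
    intro A hA
    rw [Finset.mem_powerset] at hA
    apply Finset.card_nbij' (fun C => C ∩ U) (fun B => A ∪ B)
    · intro C hC
      rw [Finset.mem_coe, Finset.mem_filter, Finset.mem_filter, Finset.mem_powerset] at hC
      rw [Finset.mem_coe, Finset.mem_filter, Finset.mem_powerset]
      obtain ⟨⟨hCNU, hPC⟩, hCN⟩ := hC
      refine ⟨Finset.inter_subset_right, ?_⟩
      have : A ∪ C ∩ U = C := by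
        rw [← hCN, ← Finset.inter_union_distrib_left]
        exact Finset.inter_eq_left.2 hCNU
      rw [this]
      exact hPC
    · intro B hB
      rw [Finset.mem_coe, Finset.mem_filter, Finset.mem_powerset] at hB
      rw [Finset.mem_coe, Finset.mem_filter, Finset.mem_filter, Finset.mem_powerset]
      obtain ⟨hBU, hPB⟩ := hB
      refine ⟨⟨Finset.union_subset_union hA hBU, hPB⟩, ?_⟩
      exact union_inter_eq_left hA (hNU.symm.mono_left hBU)
    · intro C hC
      rw [Finset.mem_coe, Finset.mem_filter, Finset.mem_filter, Finset.mem_powerset] at hC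
      obtain ⟨⟨hCNU, -⟩, hCN⟩ := hC
      show A ∪ C ∩ U = C
      rw [← hCN, ← Finset.inter_union_distrib_left]
      exact Finset.inter_eq_left.2 hCNU
    · intro B hB
      rw [Finset.mem_coe, Finset.mem_filter, Finset.mem_powerset] at hB
      show (A ∪ B) ∩ U = B
      rw [Finset.union_inter_distrib_right, Finset.disjoint_iff_inter_eq_empty.1 (hNU.mono_left hA),
        Finset.empty_union]
      exact Finset.inter_eq_left.2 hB.1
  · intro C hC
    rw [Finset.mem_coe, Finset.mem_filter, Finset.mem_powerset] at hC
    rw [Finset.mem_coe, Finset.mem_powerset]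
    exact Finset.inter_subset_right

/-- `sumToN n f = Σ_{v ∈ range (n + 1)} f v`. -/
theorem sumToN_eq_sum (n : ℕ) (f : ℕ → ℕ) : StarTable.sumToN n f = ∑ v ∈ Finset.range (n + 1), f v := by
  induction n with
  | zero => simp [StarTable.sumToN]
  | succ n ih => rw [StarTable.sumToN, ih, Finset.sum_range_succ _ (n + 1)]

omit [DecidableEq α] in
/-- The count of the table's `[]` case: `#{C ⊆ ∅ : |C| = rem, cycCond h m} = [rem = 0 ∧ cycCond h m]`. -/
theorem card_filter_powersetCard_empty (rem : ℕ) (Q : Finset α → Prop) [DecidablePred Q] :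
    (((∅ : Finset α).powersetCard rem).filter Q).card = if rem = 0 ∧ Q ∅ then 1 else 0 := by
  by_cases hrem : rem = 0
  · subst hrem
    rw [Finset.powersetCard_zero, Finset.filter_singleton]
    by_cases hQ : Q ∅
    · rw [if_pos hQ, if_pos ⟨rfl, hQ⟩, Finset.card_singleton]
    · rw [if_neg hQ, if_neg (fun h => hQ h.2), Finset.card_empty]
  · rw [Finset.powersetCard_eq_empty.2 (by rw [Finset.card_empty]; omega), Finset.filter_empty, Finset.card_empty,
      if_neg (fun h => hrem h.1)]

/-- The fibre of `A ⊆ N` in the split of the cons case: the condition on `A ∪ B` only depends on `|A|`. -/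
theorem cons_cond_iff {N A B : Finset α} {L : List (Finset α)} (hL : (N :: L).Pairwise Disjoint) (hA : A ⊆ N)
    (hB : B ⊆ unionL L) (rem hits : ℕ) (min2 : Bool) :
    ((A ∪ B).card = rem ∧ cycCond (hits + hitsL (N :: L) (A ∪ B)) (min2 && min2L (N :: L) (A ∪ B))) ↔
      (A.card + B.card = rem ∧ cycCond (hits + (if A.card = 0 then 0 else 1) + hitsL L B)
        ((min2 && (decide (A.card = 0) || decide (2 ≤ A.card))) && min2L L B)) := by
  have hd := disjoint_of_pairwise_cons hL
  have hNU := disjoint_unionL_of_pairwise_cons hL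
  have hAB : Disjoint A B := (hNU.mono_left hA).mono_right hB
  have hBN : Disjoint B N := (hNU.symm.mono_left hB)
  rw [Finset.card_union_of_disjoint hAB, hitsL_cons, min2L_cons, hitsL_union_of_subset hd hA,
    min2L_union_of_subset hd hA, union_inter_eq_left hA hBN]
  have h1 : (if A.Nonempty then 1 else 0) = (if A.card = 0 then 0 else 1) := by
    by_cases hne : A.Nonempty
    · rw [if_pos hne, if_neg (Finset.card_pos.2 hne).ne']
    · rw [if_neg hne, if_pos (Finset.card_eq_zero.2 (Finset.not_nonempty_iff_eq_empty.1 hne))]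
  have h2 : decide (A = ∅ ∨ 2 ≤ A.card) = (decide (A.card = 0) || decide (2 ≤ A.card)) := by
    by_cases h0 : A = ∅ <;> by_cases h22 : 2 ≤ A.card <;> simp [h0, h22, Finset.card_eq_zero]
  rw [h1, h2, add_assoc, Bool.and_assoc]

/-- **The cyclic count as a subset count**: for a list `L` of pairwise disjoint finsets,
`cycRec (L.map card) rem hits min2 mult = mult · #{C ⊆ ⋃L : |C| = rem, cycCond (hits + hitsL L C) (min2 && min2L L C)}`. -/
theorem cycRec_eq_card (L : List (Finset α)) (hL : L.Pairwise Disjoint) (rem hits : ℕ) (min2 : Bool) (mult : ℕ) :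
    StarTable.cycRec (L.map Finset.card) rem hits min2 mult =
      mult * (((unionL L).powersetCard rem).filter
        (fun C => cycCond (hits + hitsL L C) (min2 && min2L L C))).card := by
  induction L generalizing rem hits min2 mult with
  | nil =>
    rw [List.map_nil, StarTable.cycRec, unionL_nil, card_filter_powersetCard_empty]
    simp only [hitsL_nil, min2L_nil, Bool.and_true, add_zero]
    unfold cycCond
    split_ifs <;> simp
  | cons N L ih =>
    have hL' : L.Pairwise Disjoint := hL.of_cons
    have hNU := disjoint_unionL_of_pairwise_cons hL
    rw [List.map_cons, StarTable.cycRec, sumToN_eq_sum, unionL_cons]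
    -- the right-hand side: split the subsets of `N ∪ ⋃L` by `A = C ∩ N`
    have hsplit : (((N ∪ unionL L).powersetCard rem).filter
        (fun C => cycCond (hits + hitsL (N :: L) C) (min2 && min2L (N :: L) C))).card =
        ∑ A ∈ N.powerset, ((unionL L).powerset.filter (fun B => A.card + B.card = rem ∧
          cycCond (hits + (if A.card = 0 then 0 else 1) + hitsL L B)
            ((min2 && (decide (A.card = 0) || decide (2 ≤ A.card))) && min2L L B))).card := by
      rw [Finset.powersetCard_eq_filter, Finset.filter_filter, card_filter_powerset_union hNU]
      apply Finset.sum_congr rfl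
      intro A hA
      rw [Finset.mem_powerset] at hA
      congr 1
      apply Finset.filter_congr
      intro B hB
      rw [Finset.mem_powerset] at hB
      exact cons_cond_iff hL hA hB rem hits min2
    rw [hsplit]
    -- the fibre count depends on `A` only through `|A|`
    rw [Finset.sum_powerset_apply_card (fun v => ((unionL L).powerset.filter (fun B => v + B.card = rem ∧
          cycCond (hits + (if v = 0 then 0 else 1) + hitsL L B)
            ((min2 && (decide (v = 0) || decide (2 ≤ v))) && min2L L B))).card)]
    rw [Finset.mul_sum]
    -- restrict the range to `v ≤ min |N| rem`: the other terms vanish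
    symm
    rw [← Finset.sum_subset (Finset.range_mono (by omega : min N.card rem + 1 ≤ N.card + 1))]
    · apply Finset.sum_congr rfl
      intro v hv
      rw [Finset.mem_range] at hv
      have hvrem : v ≤ rem := by omega
      rw [ih hL', smul_eq_mul, ← mul_assoc]
      congr 1
      rw [Finset.powersetCard_eq_filter, Finset.filter_filter]
      congr 1
      apply Finset.filter_congr
      intro B _
      constructor
      · rintro ⟨h1, h2⟩
        exact ⟨by omega, h2⟩
      · rintro ⟨h1, h2⟩
        exact ⟨by omega, h2⟩
    · intro v hv hv'
      rw [Finset.mem_range] at hv hv'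
      by_cases hvN : N.card < v
      · rw [Nat.choose_eq_zero_of_lt hvN, zero_smul, mul_zero]
      · have hvrem : rem < v := by omega
        rw [Finset.filter_eq_empty_iff.2 (fun B _ h => by omega : ∀ B ∈ (unionL L).powerset,
          ¬ (v + B.card = rem ∧ cycCond (hits + (if v = 0 then 0 else 1) + hitsL L B)
            ((min2 && (decide (v = 0) || decide (2 ≤ v))) && min2L L B))), Finset.card_empty, smul_zero, mul_zero]

end CycCount

end SevenThree

end PercRepro
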